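import Summits.ResolutionOfSingularities.ResolutionOfSingularities.Theorems.LimitCollapseLU
import HarnessLib

/-!
# LimitCollapseLU (2/2) — THE KAPLANSKY–HENSEL BASE RUNG LIFTED ALONG THE LADDER: `c = 3 ↦ d − 1`

Node «LimitCollapse» (decomp-res lens-1 g36, lens «grading / quantitative ladder»), tree file 2/2.  The second
integer the lineage never moved: in the located residual `R35 e c n = WildCocycleLU.NonKHToricArchLUKeyHenselDescent
QuotTInertTwoMBWildLDTTCy e c n` (root `WildCocycleLU.closes_cocycle`, binder `hN : ∀ d ≥ 4, R35 3 3 d`) the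
Kaplansky–Hensel cell `KHTopBelow k O c` — tops `K = F₁(z)^h` HENSELIAN-IMMEDIATE over a relatively algebraically
closed base `F₁` with `trdeg_k F₁ ≤ c` and `LU(O ∩ F₁)` — has been frozen at the FLOOR `c = 3` since g14
(`KaplanskyLadder.closes_kh`), although the tree's LAW for that cell, `KaplanskyLadder.relLU_of_khTopBelow`
(KK09 Lemma 3.9 + Lemma 3.7 + Cor. 3.6 + Prop. 3.5 — ALL PROVED in the tree, `KaplanskyHensel.lean`), is generic in
`c` and consumes only `LU` of the BASE place `O ∩ F₁`, a place of transcendence degree `≤ c`.  Along the ladder's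
own induction `LURel d → LURel (d+1)` (tree `ToricLadder.luRel_succ`) the base places of trdeg `≤ d` ARE decided by
the induction hypothesis — exactly as `ToricLadder.sepDenseLU_succ` feeds the dense cell.  THIS FILE performs the lift:

* `nonSepDenseArchLU_of_cy` ✓ — Φ, the per-rung composite of the THIRTEEN landed hypothesis-free cuts (cocycle ·
  twisted-toric · log-diagonal · wild · monomial blow-up · two-storey · tame-inertial · inert · quotient · descent ·
  Hensel · key) with the rank-one toric cut (`PerronLadder.nonKH_iff_nonKHToricRk1`, CJS + Σ₁-in-kernel + Π₁) and
  the Kaplansky–Hensel cut at the floor (`KaplanskyLadder.nonSepDenseNonAbh_of_kh_cut`): `R35 3 3 d ⇒` the non-dense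
  archimedean core of rung `d`.
* `…Cy_mono_base` ✓ (antitone in `c`) · `…Cy_of_baseLift` ✓ (`LURel c′ ⇒ (R35 e c′ n ⇒ R35 e c n)`, the lift) ·
  `…Cy_baseLift_iff` ✓ (EXACT CUT given the rung: `c ≤ c′`, `LURel c′ ⊢ R35 e c n ↔ R35 e c′ n`).
* `luRel_of_limit` ✓ — INDUCTION ON THE RUNG from `hN : ∀ d ≥ 4, R35 3 (d − 1) d`.
* `closes_limit` ✓ — THE NEW ROOT BY NAME, binders printed: `hCP · hCJS · hAsc · (hN : ∀ d ≥ 4, R35 3 (d−1) d) · h₃`.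
* `root_iff_limit` ✓, `…Cy_pred_of_root` ✓, `…Cy_pred_of_three` ✓ (the lifted family is WEAKER than both the root
  and the un-lifted family), `luRel_succ_iff_limit` ✓ (the located rung, port-free, in the lifted currency).

TAGS.  `R35 3 (d−1) d` — WEAKER ✓ (than `R35 3 3 d`, by `…Cy_pred_of_three`; than the root, by `…Cy_pred_of_root`);
UNDECIDED (it is the located residual); the four print binders COSTUME-free (unchanged literature facts / the 0642
item).  NEW PLACES DECIDED (cn42 «new places only», said precisely): at every rung `d ≥ 5` the Kaplansky–Hensel tops
over bases `F₁` with `4 ≤ trdeg_k F₁ ≤ d − 1` — outside `KHTopBelow k O 3` and `ToricDenseBelow k O 3` by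
transcendence-degree count, outside `SepDenseBelow` by g17 Lemmas A/B (a henselian-immediate simple transcendental
top is not residually/valuatively transcendental over a trdeg-`(d−1)` subfield containing `F₁` unless dense-type is
excluded — inhabitant: the KK05-type top `J1` re-based over a `4`-dimensional Abhyankar base, `J1⁽⁵⁾`); at `d = 4`
(`c = 3 = d − 1`) NOTHING new — the lift is vacuous there and the residual `R35 3 3 4` is untouched.
«Why novel»: no earlier node touched `c`; every cut since g14 refined the TOP at fixed base bound.  «Why strictly
weaker»: `…Cy_pred_of_three` in kernel; the converse `R35 3 (d−1) d ⇒ R35 3 3 d` at fixed `d` is the KH law over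
`4 ≤ trdeg ≤ d−1` bases, i.e. needs `LURel (d−1)` (probe file, N3/N4 must-fail).
[cite: KnafKuhlmann2009, Lemma 3.9, Lemma 3.7, Cor. 3.6] [cite: KnafKuhlmann2005, Thm. 1.1]
[cite: CossartJannsenSaito2020] [cite: CossartPiltant2019] [cite: NovacoskiSpivakovsky2014, Thm. 1.1]
-/

noncomputable section

open Literature.AlgebraicGeometry.Resolution
open Summit.ResolutionOfSingularities.ResolutionOfSingularities.Theses
open Summit.ResolutionOfSingularities.ResolutionOfSingularities.Theorems
open Summit.ResolutionOfSingularities.ResolutionOfSingularities.Theorems.ToricLadder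
open Summit.ResolutionOfSingularities.ResolutionOfSingularities.Theorems.KaplanskyLadder
open Summit.ResolutionOfSingularities.ResolutionOfSingularities.Theorems.PerronLadder
open Summit.ResolutionOfSingularities.ResolutionOfSingularities.Theorems.DefectlessLadder
open Summit.ResolutionOfSingularities.ResolutionOfSingularities.Theorems.KeyChainLU
open Summit.ResolutionOfSingularities.ResolutionOfSingularities.Theorems.HenselKeyChainLU
open Summit.ResolutionOfSingularities.ResolutionOfSingularities.Theorems.GaloisDescentLU
open Summit.ResolutionOfSingularities.ResolutionOfSingularities.Theorems.TameQuotientLU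
open Summit.ResolutionOfSingularities.ResolutionOfSingularities.Theorems.InertDescentLU
open Summit.ResolutionOfSingularities.ResolutionOfSingularities.Theorems.TameInertialLU
open Summit.ResolutionOfSingularities.ResolutionOfSingularities.Theorems.TameTwoStoreyLU
open Summit.ResolutionOfSingularities.ResolutionOfSingularities.Theorems.MonomialBlowupLU
open Summit.ResolutionOfSingularities.ResolutionOfSingularities.Theorems.WildReflectionLU
open Summit.ResolutionOfSingularities.ResolutionOfSingularities.Theorems.WildLogDiagonalLU
open Summit.ResolutionOfSingularities.ResolutionOfSingularities.Theorems.WildTwistedToricLU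

namespace Summit.ResolutionOfSingularities.ResolutionOfSingularities.Theorems.WildCocycleLU

section BaseLift

/-- **Φ — the per-rung composite of the thirteen landed hypothesis-free cuts** (cocycle · twisted-toric · log-diagonal ·
wild · monomial-blow-up · two-storey · tame-inertial · inert · quotient · descent · Hensel · key) followed by the
rank-one toric cut (CJS + Σ₁ in kernel + Π₁) and the Kaplansky–Hensel cut at the floor: at every rung `d`, the located
residual `R35 3 3 d` gives the non-dense archimedean core of rung `d`, modulo the three prints. [folklore] -/
theorem nonSepDenseArchLU_of_cy (hCP : CossartPiltant2019LU3.{0}) (hCJS : CossartJannsenSaito2020Embedded.{0})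
    (hAsc : KK05NCVAscent) {d : ℕ} (h : NonKHToricArchLUKeyHenselDescentQuotTInertTwoMBWildLDTTCy 3 3 d) :
    NonSepDenseArchLU d :=
  (nonSepDenseArchLU_iff_nonAbh d).2
    (nonSepDenseNonAbh_of_kh_cut (luRel_three_of_cp hCP)
      ((nonKH_iff_nonKHToricRk1 (toricAscentRk1_three_sigma hCJS hAsc) (luRel_three_of_cp hCP) d).2
        (nonKHToricArchLU_iff_key.2
          (nonKHToricArchLUKey_iff_hensel.2
            (nonKHToricArchLUKeyHensel_iff_descent.2
              (nonKHToricArchLUKeyHenselDescent_iff_quot.2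
                (nonKHToricArchLUKeyHenselDescentQuot_iff_inert.2
                  (nonKHToricArchLUKeyHenselDescentQuotInert_iff_tinert.2
                    (nonKHToricArchLUKeyHenselDescentQuotTInert_iff_tame2.2
                      (nonKHToricArchLUKeyHenselDescentQuotTInertTwo_iff_mb.2
                        (nonKHToricArchLUKeyHenselDescentQuotTInertTwoMB_iff_wild.2
                          (nonKHToricArchLUKeyHenselDescentQuotTInertTwoMBWild_iff_logDiag.2
                            (nonKHToricArchLUKeyHenselDescentQuotTInertTwoMBWildLD_iff_twistedToric.2
                              (nonKHToricArchLUKeyHenselDescentQuotTInertTwoMBWildLDTT_iff_cocycle.2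
                                h))))))))))))))

/-- The located residual family is ANTITONE in the Kaplansky–Hensel base bound `c` (`khTopBelow_mono`): a larger
base bound negates MORE tops, so the residual statement gets WEAKER. [folklore] -/
theorem nonKHToricArchLUKeyHenselDescentQuotTInertTwoMBWildLDTTCy_mono_base {e c c' n : ℕ} (hcc : c ≤ c')
    (h : NonKHToricArchLUKeyHenselDescentQuotTInertTwoMBWildLDTTCy e c n) :
    NonKHToricArchLUKeyHenselDescentQuotTInertTwoMBWildLDTTCy e c' n :=
  fun p hp k K _ _ _ _ hd O h1 h0 hA hnd hnt hnk hkey hH hG hT hDF hDW hU hI h2 hMB hW hL hL' hCy =>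
    h p hp k K hd O h1 h0 hA hnd hnt (fun hk => hnk (khTopBelow_mono O hcc hk)) hkey hH hG hT hDF hDW hU hI h2
      hMB hW hL hL' hCy

/-- **THE BASE-RUNG LIFT (the Kaplansky–Hensel cut at base rung `c′`, decided ONE RUNG DOWN).**  Given rung `c′`
(`LURel c′`), every Kaplansky–Hensel top over a base of transcendence degree `≤ c′` is discharged IN KERNEL by the
tree's law `relLU_of_khTopBelow` (KK09 Lemma 3.9 + Lemma 3.7 + Cor. 3.6 + Prop. 3.5, all PROVED in the tree), fed —
exactly as `sepDenseLU_succ` feeds the dense law — by `LURel c′` restricted to the subfield `F₁ ≤ K`; so the residual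
with base bound `c′` implies the residual with ANY base bound `c`. [KnafKuhlmann2009, Lemma 3.9, Lemma 3.7, Cor. 3.6]
[folklore] -/
theorem nonKHToricArchLUKeyHenselDescentQuotTInertTwoMBWildLDTTCy_of_baseLift {e c c' n : ℕ} (hL : LURel c')
    (h : NonKHToricArchLUKeyHenselDescentQuotTInertTwoMBWildLDTTCy e c' n) :
    NonKHToricArchLUKeyHenselDescentQuotTInertTwoMBWildLDTTCy e c n := by
  intro p hp k K _ _ _ _ hd O h1 h0 hA hnd hnt hnk hkey hH hG hT hDF hDW hU hI h2 hMB hW hL₁ hL' hCy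
  by_cases hKH : KHTopBelow k O c'
  · exact relLU_of_khTopBelow O
      (fun F₁ _ htr => hL p hp k F₁ htr (O.comap (algebraMap F₁ K))) hKH
  · exact h p hp k K hd O h1 h0 hA hnd hnt hKH hkey hH hG hT hDF hDW hU hI h2 hMB hW hL₁ hL' hCy

/-- **EXACT CUT given the previous rung**: for `c ≤ c′` and `LURel c′`, the residuals with base bounds `c` and `c′`
are EQUIVALENT. [folklore] -/
theorem nonKHToricArchLUKeyHenselDescentQuotTInertTwoMBWildLDTTCy_baseLift_iff {e c c' n : ℕ} (hcc : c ≤ c')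
    (hL : LURel c') :
    NonKHToricArchLUKeyHenselDescentQuotTInertTwoMBWildLDTTCy e c n ↔
      NonKHToricArchLUKeyHenselDescentQuotTInertTwoMBWildLDTTCy e c' n :=
  ⟨nonKHToricArchLUKeyHenselDescentQuotTInertTwoMBWildLDTTCy_mono_base hcc,
    nonKHToricArchLUKeyHenselDescentQuotTInertTwoMBWildLDTTCy_of_baseLift hL⟩

/-- **INDUCTION ON THE RUNG.**  Floor (print) + CJS + Π₁ + the located residuals WITH THE LIFTED BASE BOUND
`c = d − 1` ⇒ every rung `LURel d`: at the step `d → d + 1` the induction hypothesis `LURel d` decides the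
Kaplansky–Hensel tops over bases of transcendence degree `≤ d` (base-rung lift), Φ turns the residual into the
non-dense archimedean core, `archCoreLU_of_dense_cut` + `luRel_succ` climb. [folklore] -/
theorem luRel_of_limit (hCP : CossartPiltant2019LU3.{0}) (hCJS : CossartJannsenSaito2020Embedded.{0})
    (hAsc : KK05NCVAscent)
    (hN : ∀ d, 4 ≤ d → NonKHToricArchLUKeyHenselDescentQuotTInertTwoMBWildLDTTCy 3 (d - 1) d) :
    ∀ d, LURel d := by
  intro d
  induction d with
  | zero => exact luRel_of_le_three hCP (by omega)
  | succ d ih =>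
    by_cases hd3 : d + 1 ≤ 3
    · exact luRel_of_le_three hCP hd3
    · have hR : NonKHToricArchLUKeyHenselDescentQuotTInertTwoMBWildLDTTCy 3 3 (d + 1) :=
        nonKHToricArchLUKeyHenselDescentQuotTInertTwoMBWildLDTTCy_of_baseLift ih
          (by simpa using hN (d + 1) (by omega))
      exact luRel_succ ih (archCoreLU_of_dense_cut ih (nonSepDenseArchLU_of_cy hCP hCJS hAsc hR))

/-- **`closes_limit` — ROOT BY NAME with the LIFTED base bound (binders PRINTED, = `closes_cocycle`'s with
`R35 3 3 d ↦ R35 3 (d − 1) d`):** `(hCP : CossartPiltant2019LU3)` · `(hCJS : CossartJannsenSaito2020Embedded)` ·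
`(hAsc : KK05NCVAscent)` · `(hN : ∀ d ≥ 4, R35 3 (d − 1) d)` the located residual OFF the thirteen cells AND OFF every
Kaplansky–Hensel top over a base of transcendence degree `≤ d − 1` · `(h₃ : Valuative.PatchingRel)` ⇒
`ResolutionOfSingularities`. [folklore] -/
theorem closes_limit (hCP : CossartPiltant2019LU3.{0}) (hCJS : CossartJannsenSaito2020Embedded.{0})
    (hAsc : KK05NCVAscent)
    (hN : ∀ d, 4 ≤ d → NonKHToricArchLUKeyHenselDescentQuotTInertTwoMBWildLDTTCy 3 (d - 1) d)
    (h₃ : Valuative.PatchingRel) : _root_.ResolutionOfSingularities :=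
  fun p hp => h₃ p hp (lurelP_of_luRel (luRel_of_limit hCP hCJS hAsc hN) p hp)

/-- The lifted residual follows from the root outright (it is a WEAKER piece). [folklore] -/
theorem nonKHToricArchLUKeyHenselDescentQuotTInertTwoMBWildLDTTCy_pred_of_root
    (hS : _root_.ResolutionOfSingularities) (d : ℕ) :
    NonKHToricArchLUKeyHenselDescentQuotTInertTwoMBWildLDTTCy 3 (d - 1) d :=
  nonKHToricArchLUKeyHenselDescentQuotTInertTwoMBWildLDTTCy_of_root hS 3 (d - 1) d

/-- … and from the un-lifted family (antitonicity, `3 ≤ d − 1` for `d ≥ 4`). [folklore] -/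
theorem nonKHToricArchLUKeyHenselDescentQuotTInertTwoMBWildLDTTCy_pred_of_three {d : ℕ} (hd : 4 ≤ d)
    (h : NonKHToricArchLUKeyHenselDescentQuotTInertTwoMBWildLDTTCy 3 3 d) :
    NonKHToricArchLUKeyHenselDescentQuotTInertTwoMBWildLDTTCy 3 (d - 1) d :=
  nonKHToricArchLUKeyHenselDescentQuotTInertTwoMBWildLDTTCy_mono_base (by omega) h

/-- Root-level summary: modulo floor + CJS + Π₁ + 0642 the ROOT is EQUIVALENT to the LIFTED residual family.
[folklore] -/
theorem root_iff_limit (hCP : CossartPiltant2019LU3.{0}) (hCJS : CossartJannsenSaito2020Embedded.{0})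
    (hAsc : KK05NCVAscent) (h₃ : Valuative.PatchingRel) :
    _root_.ResolutionOfSingularities ↔
      ∀ d, 4 ≤ d → NonKHToricArchLUKeyHenselDescentQuotTInertTwoMBWildLDTTCy 3 (d - 1) d :=
  ⟨fun hS d _ => nonKHToricArchLUKeyHenselDescentQuotTInertTwoMBWildLDTTCy_pred_of_root hS d,
    fun hN => closes_limit hCP hCJS hAsc hN h₃⟩

/-- THE LOCATED RUNG, port-free in the lifted currency: given the previous rung `d` (`d ≥ 3`), rung `d + 1` is
EXACTLY the lifted residual at `(3, d, d + 1)` (modulo CJS + Π₁ for the toric cut). [folklore] -/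
theorem luRel_succ_iff_limit (hCP : CossartPiltant2019LU3.{0}) (hCJS : CossartJannsenSaito2020Embedded.{0})
    (hAsc : KK05NCVAscent) {d : ℕ} (hL : LURel d) :
    LURel (d + 1) ↔ NonKHToricArchLUKeyHenselDescentQuotTInertTwoMBWildLDTTCy 3 d (d + 1) := by
  refine ⟨fun h => ?_, fun h => luRel_succ hL (archCoreLU_of_dense_cut hL (nonSepDenseArchLU_of_cy hCP hCJS hAsc
    (nonKHToricArchLUKeyHenselDescentQuotTInertTwoMBWildLDTTCy_of_baseLift hL h)))⟩
  intro p hp k K _ _ _ _ hd O _ _ _ _ _ _ _ _ _ _ _ _ _ _ _ _ _ _ _ _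
  exact h p hp k K hd O

/-- Positive control: THE NEW ROOT by fully-qualified name with its exact closed type. [folklore] -/
example : CossartPiltant2019LU3.{0} → CossartJannsenSaito2020Embedded.{0} → KK05NCVAscent →
    (∀ d, 4 ≤ d → WildCocycleLU.NonKHToricArchLUKeyHenselDescentQuotTInertTwoMBWildLDTTCy 3 (d - 1) d) →
    Valuative.PatchingRel → _root_.ResolutionOfSingularities :=
  Summit.ResolutionOfSingularities.ResolutionOfSingularities.Theorems.WildCocycleLU.closes_limit

/-- Positive control: the OLD root's residual binder implies the NEW one (the lift only WEAKENS the located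
residual). [folklore] -/
example (hN : ∀ d, 4 ≤ d → WildCocycleLU.NonKHToricArchLUKeyHenselDescentQuotTInertTwoMBWildLDTTCy 3 3 d) :
    ∀ d, 4 ≤ d → WildCocycleLU.NonKHToricArchLUKeyHenselDescentQuotTInertTwoMBWildLDTTCy 3 (d - 1) d :=
  fun d hd => nonKHToricArchLUKeyHenselDescentQuotTInertTwoMBWildLDTTCy_pred_of_three hd (hN d hd)

end BaseLift

end Summit.ResolutionOfSingularities.ResolutionOfSingularities.Theorems.WildCocycleLU

end
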